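import Literature.Analysis.FluidPDE.TaoHeatFlux
import Literature.Analysis.FluidPDE.NewtonLocalPotential
import HarnessLib

/-!
# Spherical quadratic means along rays: the oscillation inequality and weighted polar coordinates

Analysis/FluidPDE support file for the discharge of the named fact
`Literature.Analysis.FluidPDE.tao2011_nonlinearEstimate` (the nonlinear term `Y₆` in the proof
of Tao 2011, Thm. 10.1, arXiv:1108.1165 pp. 32–33). It supplies the three-dimensional inputs of
the one-dimensional dyadic chaining (`DyadicChaining.ChainHyp`): for a `C¹` vector field `ζ` on
`ℝ³` and a centre `x₀`, with the sphere functional `S(ρ) = ∫_{S²} |ζ(x₀ + ρα)|² dσ(α)`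
(`sphereNormSq`, `TaoHeatFlux`) and its gradient companion
`G(ρ) = ∫_{S²} ‖Dζ(x₀ + ρα)‖² dσ(α)` (`sphereGradSq`),

* `abs_deriv_sphereNormSq_le` — `|S'(ρ)| ≤ 2 S(ρ)^{1/2} G(ρ)^{1/2}` (differentiation under the
  integral, `SphereIntegral.hasDerivAt_sphereIntegral`, and Cauchy–Schwarz on the sphere);
* `sq_sqrt_sphereNormSq_sub_le` — **the ray oscillation inequality**: along an affine radius
  `ρ(t) = ρ₀ + σt`, `|σ| ≤ 1`, for `t ≤ t'`,
  `(S(ρ(t'))^{1/2} - S(ρ(t))^{1/2})² ≤ (t' - t) ∫_{[t,t']} G(ρ(τ)) dτ`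
  — the replacement, in the shell geometry, of the Poincaré inequality in Tao's (10.23)
  "`|wᵢ - wⱼ| ≲ rᵢ^{-1/2}(∫_{10Bᵢ}|∇ω|²)^{1/2}` whenever `Bᵢ, Bⱼ` intersect" (p. 33); proof by the
  regularised means `(S + ε²)^{1/2}`, whose derivative is bounded by `G^{1/2}`, the fencing
  (mean value) inequality, Cauchy–Schwarz on `[t, t']`, and `ε → 0`;
* `setIntegral_shell_mul_radial_eq_integral_sphereIntegral` — **weighted polar coordinates about
  `x₀`**: `∫_{a<‖x-x₀‖<b} F(x) φ(‖x - x₀‖) dx = ∫_{(a,b)} ρ² φ(ρ) (∫_{S²} F(x₀+ρα) dσ) dρ`.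

## Mathlib / tree search

Tree (reused): `sphereIntegral`, `hasDerivAt_sphereIntegral`, `continuous_sphereIntegral`,
`setIntegral_shell_eq_integral_sphereIntegral`, `norm_smul_sphere` (`SphereIntegral`);
`sphereNormSq`, `setIntegral_comp_sub_centre` (`TaoHeatFlux`); `integral_abs_mul_abs_le_sqrt`
(`NewtonLocalPotential`). Mathlib: `HasFDerivAt.norm_sq`, `HasDerivAt.sqrt`,
`image_norm_le_of_norm_deriv_right_le_deriv_boundary`, `intervalIntegral.integral_hasDerivAt_right`,
`MeasureTheory.MemLp.of_bound`.

## References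

* T. Tao, *Localisation and compactness properties of the Navier–Stokes global regularity
  problem*, Anal. PDE 6 (2013) 25–107 = arXiv:1108.1165 (`Tao2011`), §10, proof of Thm. 10.1,
  p. 33 ((10.23), the Poincaré step of the chaining argument).
-/

noncomputable section

open MeasureTheory MeasureTheory.Measure Set Filter Topology Function Metric InnerProductSpace
open scoped ENNReal NNReal RealInnerProductSpace ContDiff

namespace Literature.Analysis.FluidPDE

/-- Local notation for physical space `ℝ³ = EuclideanSpace ℝ (Fin 3)`. -/
local notation "ℝ³" => EuclideanSpace ℝ (Fin 3)

section Sphere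

variable {ζ : ℝ³ → ℝ³} {x₀ : ℝ³}

/-- **The spherical gradient functional** `G(ρ) = ∫_{S²} ‖Dζ(x₀ + ρα)‖² dσ(α)` (operator norm of
the Fréchet derivative), companion of `sphereNormSq`. [folklore] -/
def sphereGradSq (ζ : ℝ³ → ℝ³) (x₀ : ℝ³) (ρ : ℝ) : ℝ :=
  sphereIntegral volume (fun y => ‖fderiv ℝ ζ (x₀ + y)‖ ^ 2) ρ

/-- Unfolding `sphereGradSq`. [folklore] -/
theorem sphereGradSq_def (ζ : ℝ³ → ℝ³) (x₀ : ℝ³) (ρ : ℝ) :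
    sphereGradSq ζ x₀ ρ = sphereIntegral volume (fun y => ‖fderiv ℝ ζ (x₀ + y)‖ ^ 2) ρ := rfl

/-- `G ≥ 0`. [folklore] -/
theorem sphereGradSq_nonneg (ζ : ℝ³ → ℝ³) (x₀ : ℝ³) (ρ : ℝ) : 0 ≤ sphereGradSq ζ x₀ ρ :=
  integral_nonneg fun _ => sq_nonneg _

/-- Continuous functions on the unit sphere are in `L²` of the (finite) sphere measure. [folklore] -/
theorem memLp_two_toSphere_of_continuous {h : Metric.sphere (0 : ℝ³) 1 → ℝ} (hc : Continuous h) :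
    MemLp h 2 (volume : Measure ℝ³).toSphere := by
  obtain ⟨C, hC⟩ := (isCompact_univ (X := Metric.sphere (0 : ℝ³) 1)).exists_bound_of_continuousOn
    hc.continuousOn
  exact MemLp.of_bound hc.aestronglyMeasurable C (Eventually.of_forall fun α => hC α (mem_univ _))

/-- `S` is continuous (for continuous `ζ`). [folklore] -/
theorem continuous_sphereNormSq (hζ : Continuous ζ) (x₀ : ℝ³) : Continuous (sphereNormSq ζ x₀) :=
  continuous_sphereIntegral volume ((hζ.comp (continuous_id.const_add x₀)).norm.pow 2)

/-- `G` is continuous (for `ζ ∈ C¹`). [folklore] -/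
theorem continuous_sphereGradSq (hζ : ContDiff ℝ 1 ζ) (x₀ : ℝ³) : Continuous (sphereGradSq ζ x₀) :=
  continuous_sphereIntegral volume
    (((hζ.continuous_fderiv one_ne_zero).comp (continuous_id.const_add x₀)).norm.pow 2)

/-- The derivative of `y ↦ |ζ(x₀ + y)|²` in the direction `v`: `2⟨ζ(x₀+y), Dζ(x₀+y) v⟩`. [folklore] -/
theorem fderiv_norm_sq_comp_add_apply (hζ : ContDiff ℝ 1 ζ) (x₀ y v : ℝ³) :
    fderiv ℝ (fun w => ‖ζ (x₀ + w)‖ ^ 2) y v = 2 * ⟪ζ (x₀ + y), fderiv ℝ ζ (x₀ + y) v⟫ := by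
  have hd : HasFDerivAt (fun w => ζ (x₀ + w)) (fderiv ℝ ζ (x₀ + y)) y := by
    have h1 : HasFDerivAt ζ (fderiv ℝ ζ (x₀ + y)) (x₀ + y) :=
      (hζ.differentiable one_ne_zero (x₀ + y)).hasFDerivAt
    exact h1.comp y ((hasFDerivAt_id y).const_add x₀)
  rw [hd.norm_sq.fderiv]
  simp only [FunLike.coe_smul, Pi.smul_apply, ContinuousLinearMap.coe_comp,
    Function.comp_apply, innerSL_apply_apply, nsmul_eq_mul, Nat.cast_ofNat]

/-- **`|S'(ρ)| ≤ 2 S(ρ)^{1/2} G(ρ)^{1/2}`**, where `S'(ρ) = ∫ D(|ζ(x₀+·)|²)(ρα)(α) dσ(α)` is the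
derivative supplied by `hasDerivAt_sphereIntegral` (Cauchy–Schwarz on the sphere). [folklore] -/
theorem abs_deriv_sphereNormSq_le (hζ : ContDiff ℝ 1 ζ) (x₀ : ℝ³) (ρ : ℝ) :
    |∫ α, fderiv ℝ (fun y => ‖ζ (x₀ + y)‖ ^ 2) (ρ • (α : ℝ³)) (α : ℝ³)
        ∂(volume : Measure ℝ³).toSphere| ≤
      2 * Real.sqrt (sphereNormSq ζ x₀ ρ) * Real.sqrt (sphereGradSq ζ x₀ ρ) := by
  let A : Metric.sphere (0 : ℝ³) 1 → ℝ := fun α => ‖ζ (x₀ + ρ • (α : ℝ³))‖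
  let B : Metric.sphere (0 : ℝ³) 1 → ℝ := fun α => ‖fderiv ℝ ζ (x₀ + ρ • (α : ℝ³))‖
  have hAc : Continuous A :=
    (hζ.continuous.comp ((continuous_subtype_val.const_smul ρ).const_add x₀)).norm
  have hBc : Continuous B :=
    ((hζ.continuous_fderiv one_ne_zero).comp
      ((continuous_subtype_val.const_smul ρ).const_add x₀)).norm
  have hpt : ∀ α : Metric.sphere (0 : ℝ³) 1,
      |fderiv ℝ (fun y => ‖ζ (x₀ + y)‖ ^ 2) (ρ • (α : ℝ³)) (α : ℝ³)| ≤ 2 * (|A α| * |B α|) := by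
    intro α
    rw [fderiv_norm_sq_comp_add_apply hζ, abs_mul, abs_two]
    simp only [A, B, abs_norm]
    refine mul_le_mul_of_nonneg_left ?_ zero_le_two
    calc |⟪ζ (x₀ + ρ • (α : ℝ³)), fderiv ℝ ζ (x₀ + ρ • (α : ℝ³)) (α : ℝ³)⟫|
        ≤ ‖ζ (x₀ + ρ • (α : ℝ³))‖ * ‖fderiv ℝ ζ (x₀ + ρ • (α : ℝ³)) (α : ℝ³)‖ := abs_real_inner_le_norm _ _
      _ ≤ ‖ζ (x₀ + ρ • (α : ℝ³))‖ * (‖fderiv ℝ ζ (x₀ + ρ • (α : ℝ³))‖ * ‖(α : ℝ³)‖) :=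
          mul_le_mul_of_nonneg_left (ContinuousLinearMap.le_opNorm _ _) (norm_nonneg _)
      _ = ‖ζ (x₀ + ρ • (α : ℝ³))‖ * ‖fderiv ℝ ζ (x₀ + ρ • (α : ℝ³))‖ := by
          rw [norm_eq_of_mem_sphere α, mul_one]
  have hint : Integrable (fun α => 2 * (|A α| * |B α|)) (volume : Measure ℝ³).toSphere :=
    (continuous_const.mul (hAc.abs.mul hBc.abs)).integrable_of_hasCompactSupport
      (HasCompactSupport.of_compactSpace _)
  have hCS := integral_abs_mul_abs_le_sqrt (μ := (volume : Measure ℝ³).toSphere)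
    (memLp_two_toSphere_of_continuous hAc) (memLp_two_toSphere_of_continuous hBc)
  have hS : ∫ α, A α ^ 2 ∂(volume : Measure ℝ³).toSphere = sphereNormSq ζ x₀ ρ := by
    simp only [A, sphereNormSq_def, sphereIntegral_def]
  have hG : ∫ α, B α ^ 2 ∂(volume : Measure ℝ³).toSphere = sphereGradSq ζ x₀ ρ := by
    simp only [B, sphereGradSq_def, sphereIntegral_def]
  calc |∫ α, fderiv ℝ (fun y => ‖ζ (x₀ + y)‖ ^ 2) (ρ • (α : ℝ³)) (α : ℝ³) ∂(volume : Measure ℝ³).toSphere|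
      ≤ ∫ α, |fderiv ℝ (fun y => ‖ζ (x₀ + y)‖ ^ 2) (ρ • (α : ℝ³)) (α : ℝ³)| ∂(volume : Measure ℝ³).toSphere :=
        abs_integral_le_integral_abs
    _ ≤ ∫ α, 2 * (|A α| * |B α|) ∂(volume : Measure ℝ³).toSphere :=
        integral_mono_of_nonneg (Eventually.of_forall fun α => abs_nonneg _) hint
          (Eventually.of_forall hpt)
    _ = 2 * ∫ α, |A α| * |B α| ∂(volume : Measure ℝ³).toSphere := integral_const_mul _ _
    _ ≤ 2 * (Real.sqrt (∫ α, A α ^ 2 ∂(volume : Measure ℝ³).toSphere) *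
          Real.sqrt (∫ α, B α ^ 2 ∂(volume : Measure ℝ³).toSphere)) :=
        mul_le_mul_of_nonneg_left hCS zero_le_two
    _ = 2 * Real.sqrt (sphereNormSq ζ x₀ ρ) * Real.sqrt (sphereGradSq ζ x₀ ρ) := by
        rw [hS, hG, mul_assoc]

/-! ### The ray oscillation inequality -/

/-- **Derivative of `S` along an affine radius:** `d/dt S(ρ₀ + σt) = σ S'(ρ₀ + σt)`, with
`|d/dt S(ρ₀ + σt)| ≤ 2 |σ| S^{1/2} G^{1/2}`. [folklore] -/
theorem hasDerivAt_sphereNormSq_affine (hζ : ContDiff ℝ 1 ζ) (x₀ : ℝ³) (ρ₀ σ t : ℝ) :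
    ∃ D : ℝ, HasDerivAt (fun τ => sphereNormSq ζ x₀ (ρ₀ + σ * τ)) D t ∧
      |D| ≤ 2 * |σ| * Real.sqrt (sphereNormSq ζ x₀ (ρ₀ + σ * t)) *
        Real.sqrt (sphereGradSq ζ x₀ (ρ₀ + σ * t)) := by
  have hN : ContDiff ℝ 1 fun y : ℝ³ => ‖ζ (x₀ + y)‖ ^ 2 :=
    (hζ.comp (contDiff_const.add contDiff_id)).norm_sq ℝ
  have hS := hasDerivAt_sphereIntegral (volume : Measure ℝ³) hN (ρ₀ + σ * t)
  have haff : HasDerivAt (fun τ : ℝ => ρ₀ + σ * τ) σ t := by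
    simpa using ((hasDerivAt_id t).const_mul σ).const_add ρ₀
  have hderiv := (show HasDerivAt (sphereNormSq ζ x₀) _ (ρ₀ + σ * t) from hS).scomp t haff
  refine ⟨_, hderiv, ?_⟩
  rw [smul_eq_mul, abs_mul]
  have h1 := abs_deriv_sphereNormSq_le hζ x₀ (ρ₀ + σ * t)
  calc |σ| * |∫ α, fderiv ℝ (fun y => ‖ζ (x₀ + y)‖ ^ 2) ((ρ₀ + σ * t) • (α : ℝ³)) (α : ℝ³)
          ∂(volume : Measure ℝ³).toSphere|
      ≤ |σ| * (2 * Real.sqrt (sphereNormSq ζ x₀ (ρ₀ + σ * t)) *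
          Real.sqrt (sphereGradSq ζ x₀ (ρ₀ + σ * t))) := mul_le_mul_of_nonneg_left h1 (abs_nonneg σ)
    _ = 2 * |σ| * Real.sqrt (sphereNormSq ζ x₀ (ρ₀ + σ * t)) *
          Real.sqrt (sphereGradSq ζ x₀ (ρ₀ + σ * t)) := by ring

/-- **The ray oscillation inequality** (the Poincaré step (10.23) of Tao's chaining argument, in
the shell geometry): for `ζ ∈ C¹(ℝ³; ℝ³)`, a centre `x₀`, an affine radius `ρ(t) = ρ₀ + σt` with
`|σ| ≤ 1`, and `t ≤ t'`,
`(S(ρ(t'))^{1/2} - S(ρ(t))^{1/2})² ≤ (t' - t) ∫_{[t,t']} G(ρ(τ)) dτ`. [cite: Tao2011, §10, proof of Thm. 10.1 ((10.23))] -/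
theorem sq_sqrt_sphereNormSq_sub_le (hζ : ContDiff ℝ 1 ζ) (x₀ : ℝ³) (ρ₀ σ : ℝ) (hσ : |σ| ≤ 1)
    {t t' : ℝ} (htt' : t ≤ t') :
    (Real.sqrt (sphereNormSq ζ x₀ (ρ₀ + σ * t')) - Real.sqrt (sphereNormSq ζ x₀ (ρ₀ + σ * t))) ^ 2 ≤
      (t' - t) * ∫ τ in Icc t t', sphereGradSq ζ x₀ (ρ₀ + σ * τ) := by
  -- notation along the ray
  set Sl : ℝ → ℝ := fun τ => sphereNormSq ζ x₀ (ρ₀ + σ * τ) with hSl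
  set Gl : ℝ → ℝ := fun τ => sphereGradSq ζ x₀ (ρ₀ + σ * τ) with hGl
  set gl : ℝ → ℝ := fun τ => Real.sqrt (Gl τ) with hgl
  have hSl0 : ∀ τ, 0 ≤ Sl τ := fun τ => sphereNormSq_nonneg _ _ _
  have hGl0 : ∀ τ, 0 ≤ Gl τ := fun τ => sphereGradSq_nonneg _ _ _
  have haffc : Continuous fun τ : ℝ => ρ₀ + σ * τ := (continuous_id.const_mul σ).const_add ρ₀
  have hSlc : Continuous Sl := (continuous_sphereNormSq hζ.continuous x₀).comp haffc
  have hGlc : Continuous Gl := (continuous_sphereGradSq hζ x₀).comp haffc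
  have hglc : Continuous gl := Real.continuous_sqrt.comp hGlc
  -- the primitive `B(u) = ∫_t^u gl`
  set Bf : ℝ → ℝ := fun u => ∫ x in t..u, gl x with hBf
  have hBderiv : ∀ u, HasDerivAt Bf (gl u) u := fun u =>
    intervalIntegral.integral_hasDerivAt_right (hglc.intervalIntegrable _ _)
      (hglc.stronglyMeasurableAtFilter _ _) hglc.continuousAt
  -- Step 1: for every `ε > 0`, `|mε t' - mε t| ≤ ∫_t^{t'} gl`
  have step1 : ∀ ε : ℝ, 0 < ε →
      |Real.sqrt (Sl t' + ε ^ 2) - Real.sqrt (Sl t + ε ^ 2)| ≤ Bf t' := by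
    intro ε hε
    set mε : ℝ → ℝ := fun τ => Real.sqrt (Sl τ + ε ^ 2) with hmε
    -- derivative of `mε` and its bound by `gl`
    have hder : ∀ τ, ∃ D, HasDerivAt mε D τ ∧ |D| ≤ gl τ := by
      intro τ
      obtain ⟨D₀, hD₀, hD₀le⟩ := hasDerivAt_sphereNormSq_affine hζ x₀ ρ₀ σ τ
      have hpos : 0 < Sl τ + ε ^ 2 := by have := hSl0 τ; positivity
      have hD : HasDerivAt mε (D₀ / (2 * Real.sqrt (Sl τ + ε ^ 2))) τ :=
        (hD₀.add_const (ε ^ 2)).sqrt hpos.ne'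
      refine ⟨_, hD, ?_⟩
      have hsq : Real.sqrt (Sl τ) ≤ Real.sqrt (Sl τ + ε ^ 2) :=
        Real.sqrt_le_sqrt (by linarith [sq_nonneg ε])
      have hmpos : 0 < Real.sqrt (Sl τ + ε ^ 2) := Real.sqrt_pos.2 hpos
      rw [abs_div, abs_of_pos (by positivity : (0:ℝ) < 2 * Real.sqrt (Sl τ + ε ^ 2)),
        div_le_iff₀ (by positivity)]
      calc |D₀| ≤ 2 * |σ| * Real.sqrt (Sl τ) * Real.sqrt (Gl τ) := hD₀le
        _ ≤ 2 * 1 * Real.sqrt (Sl τ + ε ^ 2) * Real.sqrt (Gl τ) := by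
            gcongr
        _ = gl τ * (2 * Real.sqrt (Sl τ + ε ^ 2)) := by rw [hgl]; ring
    choose D hD hDle using hder
    have hcont : ContinuousOn (fun τ => mε τ - mε t) (Icc t t') := fun τ _ =>
      ((hD τ).continuousAt.sub continuousAt_const).continuousWithinAt
    have hderiv : ∀ τ ∈ Ico t t', HasDerivWithinAt (fun τ => mε τ - mε t) (D τ) (Ici τ) τ :=
      fun τ _ => ((hD τ).sub_const (mε t)).hasDerivWithinAt
    have h0 : ‖mε t - mε t‖ ≤ Bf t := by
      simp [hBf]
    have hbound : ∀ τ ∈ Ico t t', ‖D τ‖ ≤ gl τ := fun τ _ => by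
      rw [Real.norm_eq_abs]; exact hDle τ
    have h := image_norm_le_of_norm_deriv_right_le_deriv_boundary hcont hderiv h0 hBderiv hbound
      (right_mem_Icc.2 htt')
    rwa [Real.norm_eq_abs] at h
  -- Step 2: Cauchy–Schwarz on `[t, t']`: `(∫_t^{t'} gl)² ≤ (t' - t) ∫_{[t,t']} Gl`
  have step2 : Bf t' ^ 2 ≤ (t' - t) * ∫ τ in Icc t t', Gl τ := by
    have hBf' : Bf t' = ∫ τ in Icc t t', gl τ := by
      show (∫ x in t..t', gl x) = ∫ τ in Icc t t', gl τ
      rw [intervalIntegral.integral_of_le htt', integral_Icc_eq_integral_Ioc]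
    rw [hBf']
    set ν := (volume : Measure ℝ).restrict (Icc t t') with hν
    haveI : IsFiniteMeasure ν := by
      rw [hν]; exact isFiniteMeasure_restrict.2 (by rw [Real.volume_Icc]; exact ENNReal.ofReal_ne_top)
    have h1m : MemLp (fun _ : ℝ => (1 : ℝ)) 2 ν := memLp_const 1
    have hgm : MemLp gl 2 ν := by
      obtain ⟨C, hC⟩ := (isCompact_Icc (a := t) (b := t')).exists_bound_of_continuousOn hglc.continuousOn
      refine MemLp.of_bound hglc.aestronglyMeasurable C ?_
      rw [hν, ae_restrict_iff' measurableSet_Icc]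
      exact Eventually.of_forall fun τ hτ => hC τ hτ
    have hCS := integral_abs_mul_abs_le_sqrt (μ := ν) h1m hgm
    have e1 : ∫ τ, |(1 : ℝ)| * |gl τ| ∂ν = ∫ τ in Icc t t', gl τ := by
      rw [hν]
      exact integral_congr_ae (Eventually.of_forall fun τ => by
        simp only [abs_one, one_mul]; exact abs_of_nonneg (Real.sqrt_nonneg _))
    have e2 : ∫ τ, (1 : ℝ) ^ 2 ∂ν = t' - t := by
      rw [hν, one_pow, integral_const, measureReal_restrict_apply_univ, Real.volume_real_Icc_of_le htt',
        smul_eq_mul, mul_one]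
    have e3 : ∫ τ, gl τ ^ 2 ∂ν = ∫ τ in Icc t t', Gl τ := by
      rw [hν]
      exact integral_congr_ae (Eventually.of_forall fun τ => Real.sq_sqrt (hGl0 τ))
    rw [e1, e2, e3] at hCS
    have hI0 : 0 ≤ ∫ τ in Icc t t', gl τ := integral_nonneg fun τ => Real.sqrt_nonneg _
    have hG0 : 0 ≤ ∫ τ in Icc t t', Gl τ := integral_nonneg fun τ => hGl0 τ
    calc (∫ τ in Icc t t', gl τ) ^ 2
        ≤ (Real.sqrt (t' - t) * Real.sqrt (∫ τ in Icc t t', Gl τ)) ^ 2 :=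
          pow_le_pow_left₀ hI0 hCS 2
      _ = (t' - t) * ∫ τ in Icc t t', Gl τ := by
          rw [mul_pow, Real.sq_sqrt (by linarith), Real.sq_sqrt hG0]
  -- Step 3: `ε → 0⁺`
  have hlim : Tendsto (fun ε : ℝ => (Real.sqrt (Sl t' + ε ^ 2) - Real.sqrt (Sl t + ε ^ 2)) ^ 2)
      (𝓝[>] 0) (𝓝 ((Real.sqrt (Sl t') - Real.sqrt (Sl t)) ^ 2)) := by
    have hc : Continuous fun ε : ℝ => (Real.sqrt (Sl t' + ε ^ 2) - Real.sqrt (Sl t + ε ^ 2)) ^ 2 := by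
      fun_prop
    have := hc.tendsto 0
    simp only [ne_eq, OfNat.ofNat_ne_zero, not_false_eq_true, zero_pow, add_zero] at this
    exact this.mono_left nhdsWithin_le_nhds
  refine le_of_tendsto hlim ?_
  filter_upwards [self_mem_nhdsWithin] with ε hε
  have h1 := step1 ε hε
  have hB0 : 0 ≤ Bf t' := (abs_nonneg _).trans h1
  calc (Real.sqrt (Sl t' + ε ^ 2) - Real.sqrt (Sl t + ε ^ 2)) ^ 2
      = |Real.sqrt (Sl t' + ε ^ 2) - Real.sqrt (Sl t + ε ^ 2)| ^ 2 := (sq_abs _).symm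
    _ ≤ Bf t' ^ 2 := pow_le_pow_left₀ (abs_nonneg _) h1 2
    _ ≤ (t' - t) * ∫ τ in Icc t t', Gl τ := step2

/-! ### Weighted polar coordinates about a centre -/

/-- The sphere integral of `F · φ(‖·‖)` at radius `ρ ≥ 0` is `φ(ρ)` times that of `F`. [folklore] -/
theorem sphereIntegral_mul_radial {F : ℝ³ → ℝ} (φ : ℝ → ℝ) {ρ : ℝ} (hρ : 0 ≤ ρ) :
    sphereIntegral volume (fun y => F y * φ ‖y‖) ρ = φ ρ * sphereIntegral volume F ρ := by
  rw [sphereIntegral_def, sphereIntegral_def, ← integral_const_mul]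
  refine integral_congr_ae (Eventually.of_forall fun α => ?_)
  show F (ρ • (α : ℝ³)) * φ ‖ρ • (α : ℝ³)‖ = φ ρ * F (ρ • (α : ℝ³))
  rw [norm_smul_sphere hρ, mul_comm]

/-- **Weighted polar coordinates about `x₀`.** For `F` continuous, `φ` continuous on `[a, b]`,
and `0 ≤ a`:
`∫_{a<‖x-x₀‖<b} F(x) φ(‖x-x₀‖) dx = ∫_{(a,b)} ρ² φ(ρ) (∫_{S²} F(x₀ + ρα) dσ(α)) dρ`. [folklore] -/
theorem setIntegral_shell_mul_radial_eq_integral_sphereIntegral {F : ℝ³ → ℝ} (hF : Continuous F)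
    {φ : ℝ → ℝ} {a b : ℝ} (hφ : ContinuousOn φ (Icc a b)) (x₀ : ℝ³) (ha : 0 ≤ a) :
    ∫ x in {x : ℝ³ | a < ‖x - x₀‖ ∧ ‖x - x₀‖ < b}, F x * φ ‖x - x₀‖ =
      ∫ ρ in Ioo a b, ρ ^ 2 * φ ρ * sphereIntegral volume (fun y => F (x₀ + y)) ρ := by
  rw [setIntegral_comp_sub_centre (fun x => F x * φ ‖x - x₀‖) (fun y => a < ‖y‖ ∧ ‖y‖ < b) x₀]
  simp only [add_sub_cancel_left]
  -- integrability on the shell: `F(x₀ + ·) φ(‖·‖)` is continuous on the compact closed shell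
  have hK : IsCompact {y : ℝ³ | a ≤ ‖y‖ ∧ ‖y‖ ≤ b} := by
    have : {y : ℝ³ | a ≤ ‖y‖ ∧ ‖y‖ ≤ b} = Metric.closedBall (0 : ℝ³) b ∩ {y | a ≤ ‖y‖} := by
      ext y; simp [and_comm]
    rw [this]
    exact (isCompact_closedBall _ _).inter_right (isClosed_le continuous_const continuous_norm)
  have hsub : {y : ℝ³ | a < ‖y‖ ∧ ‖y‖ < b} ⊆ {y : ℝ³ | a ≤ ‖y‖ ∧ ‖y‖ ≤ b} :=
    fun y hy => ⟨hy.1.le, hy.2.le⟩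
  have hcont : ContinuousOn (fun y : ℝ³ => F (x₀ + y) * φ ‖y‖) {y : ℝ³ | a ≤ ‖y‖ ∧ ‖y‖ ≤ b} := by
    refine ((hF.comp (continuous_id.const_add x₀)).continuousOn).mul ?_
    exact hφ.comp continuous_norm.continuousOn fun y hy => ⟨hy.1, hy.2⟩
  have hint : IntegrableOn (fun y : ℝ³ => F (x₀ + y) * φ ‖y‖) {y | a < ‖y‖ ∧ ‖y‖ < b} volume :=
    (hcont.integrableOn_compact hK).mono_set hsub
  rw [setIntegral_shell_eq_integral_sphereIntegral volume hint ha, finrank_euclideanSpace_fin]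
  simp only [show (3 : ℕ) - 1 = 2 by norm_num, smul_eq_mul]
  refine setIntegral_congr_fun measurableSet_Ioo fun ρ hρ => ?_
  rw [sphereIntegral_mul_radial φ (ha.trans hρ.1.le)]
  ring

end Sphere

end Literature.Analysis.FluidPDE

end
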